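import Literature.MathematicalPhysics.QuantumFieldTheory.Balaban1983to89.T3AveragedTailProfile
import Summits.QuantumFields.YangMills.Theses.UnitScaleTilt

/-!
# Crux `HistoryTailL` (stmt-QuantumFields-19936) — line «entropy-floor»: the glue stub `stub_historyTailOfGeometric` PROVED.
# A per-plaquette large-field tail GEOMETRIC IN THE HEIGHT with ratio beating plaquette entropy (`D·ρ^(K−j)`, `ρ·L³ < 1`) gives
# `UnitScaleTilt.HistoryTailL` (the bookkeeping half of the line; the floor itself stays open).

Cell `ym3-torus` (YM ladder rung R3 = continuum SU(2) Yang–Mills on the three-torus; NOT the Clay problem), width seat `ym-ust-19936-w2`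
gen 8 on the crux `HistoryTailL`.  The ideator line «entropy-floor» (`Cruxes/HistoryTailL/Lines/entropy_floor.lean`, seat ym-r3-idea-2 g4)
composes `HistoryTailL_of := stub_historyTailOfGeometric stub_geometricTail`; THIS FILE discharges the bookkeeping stub BY ITS TYPE
(`stub_historyTailOfGeometric`, §3), so that line rests on its ONE analytic stub `stub_geometricTail` (the floor itself, XL, NOT
proved here), and records the door `historyTailL_of_geometricTail : <floor, L-uniform prefix> → UnitScaleTilt.HistoryTailL`.

THE ARGUMENT (elementary bookkeeping; [Balaban1985UV3] (1)–(3) p.256 for the lattices `T^{(j)}` of the `K`-th approximation —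
`2L^{m+K−j}` sites per direction — and (71) p.273 for the shape of the large-field estimate):
* §1 geometric profiles: for `0 ≤ r < 1` the profile `q(i) = A·r^i` is summable with summable tail sums `Σ_t q(t+n) = A·r^n/(1−r)`.
* §2 `averagedTailAt_of_geometricTail`: at height `j` of cut-off `K` the single-height large-field event `{¬PlaqSmall θ(K−j) (Ū^{j})}` is
  the union over the `≤ 9·(2L^{m+K−j})³ = 72·L^{3m}·(L³)^{K−j}` plaquettes `p` of `T^{(j)}` of the single-plaquette events
  `{θ(K−j) ≤ |Ū^{j}(∂p) − 1|}` (`T3CruxEstimates.real_not_plaqSmall_comp_le_sum` pulled back along the `j`-fold averaging); a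
  per-plaquette bound `D·ρ^{K−j}` therefore gives the profile `q(i) = 72·D·L^{3m}·(ρL³)^i`, geometric of ratio `ρL³ < 1` ⇒
  `T3BareTailProfile.AveragedTailAt` (NO hypothesis on `b₀, p₀` is used at this step), hence (`0 < γ ≤ 1`, `0 < b₀`, `1 ≤ p₀`; the bare
  height is the landed `bareTailAt`) `HeightTailAt` and `HistoryTailAt F γ b₀ p₀ m` for every `m ≥ 1`
  (`T3BareTailProfile.historyTailAt_of_averagedTailAt`).
* §3 the L-uniform packaging: `historyTailL_of_geometricTail` and `stub_historyTailOfGeometric` (the stub's type VERBATIM).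
(The nestings INTO the floor — the Gaussian-in-threshold schema of `T3AveragedTailProfile`, `StretchedTail.OrliczTailL`,
`ModerateWindow.WindowMGFL` — are the sibling support file `EntropyFloorGeometricTailOfOrlicz`, seat `ym-ust-19936-w6`; not here.)

WHAT THIS IS NOT.  The floor `stub_geometricTail` (a per-plaquette rate `o(L^{−3i})` in the height `i = K − j` under the full Wilson–Gibbs
law, uniformly in the cut-off) is the HYPOTHESIS and stays open; nothing here proves the crux `HistoryTailL`, the rung R3 (`YM3TorusSU2`),
d = 4, a continuum limit or a mass gap.  YM₃ on T³ is rung R3 of the programme, NOT the Clay problem.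

References: T. Bałaban, CMP **102** (1985) 255–275 [Balaban1985UV3] ((1)–(3) p.256, (7) p.257, (71) p.273).
-/

noncomputable section

open MeasureTheory
open Literature.MathematicalPhysics.QuantumFieldTheory (Plaquette)
open Literature.MathematicalPhysics.QuantumFieldTheory.Balaban1983to89
open Literature.MathematicalPhysics.QuantumFieldTheory.Balaban1983to89.T3ContinuumYM3Torus
open Literature.MathematicalPhysics.QuantumFieldTheory.Balaban1983to89.T3UnitScaleTilt
open Literature.MathematicalPhysics.QuantumFieldTheory.Balaban1983to89.T3UnitLawDensityEML
open Literature.MathematicalPhysics.QuantumFieldTheory.Balaban1983to89.T3CruxEstimates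
open Literature.MathematicalPhysics.QuantumFieldTheory.Balaban1983to89.T3BareTailProfile
open Literature.MathematicalPhysics.QuantumFieldTheory.Balaban1983to89.T3AveragedTailProfile

namespace Summit.QuantumFields.YangMills.Theorems.EntropyFloorHistoryTailOfGeometric

/-! ## §1 Geometric profiles: summable, with summable tail sums -/

/-- The tail sums of a geometric profile: `Σ_t A·r^(t+n) = (A·(1−r)⁻¹)·r^n` for `0 ≤ r < 1`. [folklore] -/
theorem tsum_geometric_profile_shift {A r : ℝ} (hr0 : 0 ≤ r) (hr1 : r < 1) (n : ℕ) :
    ∑' t, A * r ^ (t + n) = A * (1 - r)⁻¹ * r ^ n := by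
  have h1 : (fun t => A * r ^ (t + n)) = fun t => (A * r ^ n) * r ^ t := by
    funext t; rw [pow_add]; ring
  rw [h1, tsum_mul_left, tsum_geometric_of_lt_one hr0 hr1]
  ring

/-- A geometric profile `q(i) = A·r^i`, `0 ≤ r < 1`, is summable. [folklore] -/
theorem summable_geometric_profile (A : ℝ) {r : ℝ} (hr0 : 0 ≤ r) (hr1 : r < 1) : Summable fun i => A * r ^ i :=
  (summable_geometric_of_lt_one hr0 hr1).mul_left A

/-- … and so is the sequence of its tail sums `n ↦ Σ_t q(t+n)`. [folklore] -/
theorem summable_tsum_geometric_profile_shift (A : ℝ) {r : ℝ} (hr0 : 0 ≤ r) (hr1 : r < 1) :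
    Summable fun n => ∑' t, A * r ^ (t + n) := by
  have heq : (fun n => ∑' t, A * r ^ (t + n)) = fun n => (A * (1 - r)⁻¹) * r ^ n := by
    funext n; exact tsum_geometric_profile_shift hr0 hr1 n
  rw [heq]
  exact summable_geometric_profile _ hr0 hr1

/-! ## §2 The floor currency gives the averaged heights of K2, hence `HistoryTailAt` -/

/-- The height-`j` lattice of the `K`-th approximation has `2L^{m+K−j}` sites per direction (`j ≤ K`). [cite: Balaban1985UV3, (1)-(3) p.256] -/
theorem sitesPerDir_eq (F : T3Family) {K j : ℕ} (hj : j ≤ K) :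
    (F.P K).sitesPerDir j = 2 * F.L ^ (F.m + (K - j)) := by
  show 2 * F.L ^ (F.m + K - j) = 2 * F.L ^ (F.m + (K - j))
  rw [show F.m + K - j = F.m + (K - j) by omega]

/-- **THE PLAQUETTE ENTROPY OF HEIGHT `j`**: `#Plaq(T^{(j)}) ≤ 72·L^{3m}·(L³)^{K−j}` (`j ≤ K`): `≤ 9·(sites per direction)³` (crude:
`d² = 9` plane labels per site; the count inside `T3AveragedTailProfile.averagedTailAt_of_perPlaquette`) and `2L^{m+K−j}` sites per direction.
[cite: Balaban1985UV3, (1)-(3) p.256] -/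
theorem card_plaq_le (F : T3Family) {K j : ℕ} (hj : j ≤ K) :
    (Fintype.card (Plaq (F.P K) j) : ℝ) ≤ 72 * (F.L : ℝ) ^ (3 * F.m) * ((F.L : ℝ) ^ 3) ^ (K - j) := by
  -- `#Plaq ≤ 9·(sites per direction)³`
  have h1 : Fintype.card (Plaq (F.P K) j) = Fintype.card (Plaquette 3 ((F.P K).sitesPerDir j)) :=
    Fintype.card_congr (plaqEquiv (P := F.P K) j)
  have h2 : Fintype.card (Plaquette 3 ((F.P K).sitesPerDir j)) ≤ ((F.P K).sitesPerDir j) ^ 3 * 3 ^ 2 := by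
    rw [Fintype.card_prod, Fintype.card_fun, ZMod.card, Fintype.card_fin]
    gcongr
    calc Fintype.card {p : Fin 3 × Fin 3 // p.1 < p.2} ≤ Fintype.card (Fin 3 × Fin 3) := Fintype.card_subtype_le _
      _ = 3 ^ 2 := by rw [Fintype.card_prod, Fintype.card_fin]; norm_num
  have h3 : (Fintype.card (Plaq (F.P K) j) : ℝ) ≤ 9 * ((F.P K).sitesPerDir j : ℝ) ^ 3 := by
    rw [h1]
    calc (Fintype.card (Plaquette 3 ((F.P K).sitesPerDir j)) : ℝ) ≤ (((F.P K).sitesPerDir j) ^ 3 * 3 ^ 2 : ℕ) := by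
          exact_mod_cast h2
      _ = 9 * ((F.P K).sitesPerDir j : ℝ) ^ 3 := by push_cast; ring
  -- `(2L^{m+K−j})³ = 8·L^{3m}·(L³)^{K−j}`
  have hM : ((F.P K).sitesPerDir j : ℝ) ^ 3 = 8 * (F.L : ℝ) ^ (3 * F.m) * ((F.L : ℝ) ^ 3) ^ (K - j) := by
    rw [sitesPerDir_eq F hj]; push_cast; ring
  calc (Fintype.card (Plaq (F.P K) j) : ℝ) ≤ 9 * ((F.P K).sitesPerDir j : ℝ) ^ 3 := h3
    _ = 72 * (F.L : ℝ) ^ (3 * F.m) * ((F.L : ℝ) ^ 3) ^ (K - j) := by rw [hM]; ring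

/-- **THE AVERAGED HEIGHTS OF K2 FROM THE FLOOR** (`0 ≤ γ`; NO hypothesis on the profile parameters `b₀, p₀`): if for some `D ≥ 0` and
`0 ≤ ρ` with `ρ·L³ < 1` every block-averaged plaquette at every height `1 ≤ j ≤ K` of every approximation `K` has Gibbs tail
`Gibbs_K{θ(K−j) ≤ |Ū^{j}(∂p) − 1|} ≤ D·ρ^{K−j}`, then `AveragedTailAt F γ b₀ p₀` holds with the geometric profile
`q(i) = 72·D·L^{3m}·(ρL³)^i`: the union bound over the `≤ 72·L^{3m}·(L³)^{K−j}` plaquettes of height `j`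
(`T3CruxEstimates.real_not_plaqSmall_comp_le_sum` pulled back along the `j`-fold averaging). [cite: Balaban1985UV3, (71) p.273] -/
theorem averagedTailAt_of_geometricTail (F : T3Family) {γ : ℝ} (b₀ p₀ : ℝ) (hγ : 0 ≤ γ)
    (h : ∃ (D ρ : ℝ), 0 ≤ D ∧ 0 ≤ ρ ∧ ρ * (F.L : ℝ) ^ 3 < 1 ∧
      ∀ (K j : ℕ), 1 ≤ j → j ≤ K → ∀ p : Plaq (F.P K) j,
        (gibbsK F ℰp γ K).real
            {U | θBal F.L γ b₀ p₀ (K - j) ≤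
              GaugeGroup.dist1 (GaugeField.plaqHol
                (Averaging.iter (fun i => BlockAveraging.blockAvg (P := F.P K) (j := i) ℰp) j U) p)} ≤
          D * ρ ^ (K - j)) :
    AveragedTailAt F γ b₀ p₀ := by
  obtain ⟨D, ρ, hD, hρ, hρL, hbound⟩ := h
  have hL0 : (0 : ℝ) ≤ F.L := Nat.cast_nonneg _
  -- the ratio `r = ρ·L³` and the constant `A' = 72·D·L^{3m}`
  set r : ℝ := ρ * (F.L : ℝ) ^ 3 with hr
  have hr0 : 0 ≤ r := mul_nonneg hρ (pow_nonneg hL0 3)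
  set A' : ℝ := 72 * D * (F.L : ℝ) ^ (3 * F.m) with hA'
  have hA'0 : 0 ≤ A' := by positivity
  refine ⟨fun i => A' * r ^ i, fun i => mul_nonneg hA'0 (pow_nonneg hr0 i), summable_geometric_profile A' hr0 hρL,
    summable_tsum_geometric_profile_shift A' hr0 hρL, fun K j hj1 hjK => ?_⟩
  -- the union bound over the plaquettes of height `j`, pulled back along the `j`-fold averaging
  haveI := isProbabilityMeasure_gibbsK F ℰp hγ K
  have hunion := real_not_plaqSmall_comp_le_sum (gibbsK F ℰp γ K)
    (fun U => Averaging.iter (fun i => BlockAveraging.blockAvg (P := F.P K) (j := i) ℰp) j U) (θBal F.L γ b₀ p₀ (K - j))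
  refine hunion.trans ?_
  refine (Finset.sum_le_sum fun p _ => hbound K j hj1 hjK p).trans ?_
  rw [Finset.sum_const, Finset.card_univ, nsmul_eq_mul]
  have hnonneg : 0 ≤ D * ρ ^ (K - j) := mul_nonneg hD (pow_nonneg hρ _)
  calc (Fintype.card (Plaq (F.P K) j) : ℝ) * (D * ρ ^ (K - j))
      ≤ (72 * (F.L : ℝ) ^ (3 * F.m) * ((F.L : ℝ) ^ 3) ^ (K - j)) * (D * ρ ^ (K - j)) :=
        mul_le_mul_of_nonneg_right (card_plaq_le F hjK) hnonneg
    _ = A' * r ^ (K - j) := by rw [hA', hr, mul_pow]; ring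

/-- **K2's ESTIMATE FROM THE FLOOR** (`0 < γ ≤ 1`, `0 < b₀`, `1 ≤ p₀`): `HeightTailAt F γ b₀ p₀` (the bare height is the landed
`T3BareTailProfile.bareTailAt`). [cite: Balaban1985UV3, (71) p.273] -/
theorem heightTailAt_of_geometricTail (F : T3Family) {γ b₀ p₀ : ℝ} (hγ : 0 < γ) (hγ1 : γ ≤ 1) (hb₀ : 0 < b₀) (hp₀ : 1 ≤ p₀)
    (h : ∃ (D ρ : ℝ), 0 ≤ D ∧ 0 ≤ ρ ∧ ρ * (F.L : ℝ) ^ 3 < 1 ∧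
      ∀ (K j : ℕ), 1 ≤ j → j ≤ K → ∀ p : Plaq (F.P K) j,
        (gibbsK F ℰp γ K).real
            {U | θBal F.L γ b₀ p₀ (K - j) ≤
              GaugeGroup.dist1 (GaugeField.plaqHol
                (Averaging.iter (fun i => BlockAveraging.blockAvg (P := F.P K) (j := i) ℰp) j U) p)} ≤
          D * ρ ^ (K - j)) :
    HeightTailAt F γ b₀ p₀ :=
  (heightTailAt_iff_averagedTailAt F hγ hγ1 hb₀ hp₀).mpr (averagedTailAt_of_geometricTail F b₀ p₀ hγ.le h)

/-- **… AND THE ROUTE'S K2 BODY**: `HistoryTailAt F γ b₀ p₀ m` for every `m ≥ 1`, from the floor. [cite: Balaban1985UV3, (71) p.273] -/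
theorem historyTailAt_of_geometricTail (F : T3Family) {γ b₀ p₀ : ℝ} (hγ : 0 < γ) (hγ1 : γ ≤ 1) (hb₀ : 0 < b₀) (hp₀ : 1 ≤ p₀)
    {m : ℕ} (hm : 0 < m)
    (h : ∃ (D ρ : ℝ), 0 ≤ D ∧ 0 ≤ ρ ∧ ρ * (F.L : ℝ) ^ 3 < 1 ∧
      ∀ (K j : ℕ), 1 ≤ j → j ≤ K → ∀ p : Plaq (F.P K) j,
        (gibbsK F ℰp γ K).real
            {U | θBal F.L γ b₀ p₀ (K - j) ≤
              GaugeGroup.dist1 (GaugeField.plaqHol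
                (Averaging.iter (fun i => BlockAveraging.blockAvg (P := F.P K) (j := i) ℰp) j U) p)} ≤
          D * ρ ^ (K - j)) :
    HistoryTailAt F γ b₀ p₀ m :=
  historyTailAt_of_averagedTailAt F hγ hγ1 hb₀ hp₀ hm (averagedTailAt_of_geometricTail F b₀ p₀ hγ.le h)

/-! ## §3 The L-uniform packaging: the door into `UnitScaleTilt.HistoryTailL` and the stub BY ITS TYPE -/

/-- **THE DOOR INTO THE CRUX**: the floor, under the L-uniform quantifier prefix of the line «entropy-floor» (profile `(b₀, p₀)` beyond any
thresholds `(b₁, p₁)`, fixed BEFORE the top fraction `m`; one `γ₁ ≤ 1` serving every `m`; per family and coupling a rate `D·ρ^{K−j}` with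
`ρ·L³ < 1`) IMPLIES `UnitScaleTilt.HistoryTailL` (stmt-QuantumFields-19936) — §2 per family, `γ ≤ γ₁ ≤ 1`, `1 ≤ 2 < p₀`.  CONDITIONAL: the
floor is NOT proved here. [cite: Balaban1985UV3, (71) p.273] -/
theorem historyTailL_of_geometricTail
    (hG : ∀ (L : ℕ) (b₁ p₁ : ℝ), ∃ (b₀ p₀ : ℝ), b₁ ≤ b₀ ∧ p₁ ≤ p₀ ∧ 0 < b₀ ∧ 2 < p₀ ∧ ∃ γ₁ : ℝ, 0 < γ₁ ∧ γ₁ ≤ 1 ∧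
      ∀ (F : T3Family) (γ : ℝ), F.L = L → 0 < γ → γ ≤ γ₁ → ∃ (D ρ : ℝ), 0 ≤ D ∧ 0 ≤ ρ ∧ ρ * (L : ℝ) ^ 3 < 1 ∧
        ∀ (K j : ℕ), 1 ≤ j → j ≤ K → ∀ (p : Plaq (F.P K) j),
          (gibbsK F ℰp γ K).real {U | θBal F.L γ b₀ p₀ (K - j) ≤
              GaugeGroup.dist1 (GaugeField.plaqHol (Averaging.iter (fun i => BlockAveraging.blockAvg (P := F.P K) (j := i) ℰp) j U) p)}
            ≤ D * ρ ^ (K - j)) :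
    Summit.QuantumFields.YangMills.Theses.UnitScaleTilt.HistoryTailL := by
  unfold Summit.QuantumFields.YangMills.Theses.UnitScaleTilt.HistoryTailL
  intro L b₁ p₁
  obtain ⟨b₀, p₀, hb, hp, hb₀, hp₀, γ₁, hγ₁, hγ₁1, hfam⟩ := hG L b₁ p₁
  refine ⟨b₀, p₀, hb, hp, hb₀, hp₀, fun m hm => ⟨γ₁, hγ₁, fun F γ hFL hγ hγle => ?_⟩⟩
  obtain ⟨D, ρ, hD, hρ, hρL, hbound⟩ := hfam F γ hFL hγ hγle
  refine historyTailAt_of_geometricTail F hγ (hγle.trans hγ₁1) hb₀ (by linarith) hm ⟨D, ρ, hD, hρ, ?_, hbound⟩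
  rw [hFL]
  exact hρL

/-- **THE REGISTERED STUB `stub_historyTailOfGeometric` OF LINE «entropy-floor» BY ITS TYPE** (verbatim): the floor currency closes
`UnitScaleTilt.HistoryTailL`.  With this the line's composition `HistoryTailL_of` rests on `stub_geometricTail` alone. CONDITIONAL on that
floor, which is NOT proved here. [cite: Balaban1985UV3, (71) p.273] -/
theorem stub_historyTailOfGeometric :
    open Literature.MathematicalPhysics.QuantumFieldTheory.Balaban1983to89 Literature.MathematicalPhysics.QuantumFieldTheory.Balaban1983to89.T3ContinuumYM3Torus
      Literature.MathematicalPhysics.QuantumFieldTheory.Balaban1983to89.T3UnitScaleTilt Literature.MathematicalPhysics.QuantumFieldTheory.Balaban1983to89.T3UnitLawDensityEML in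
    (∀ (L : ℕ) (b₁ p₁ : ℝ), ∃ (b₀ p₀ : ℝ), b₁ ≤ b₀ ∧ p₁ ≤ p₀ ∧ 0 < b₀ ∧ 2 < p₀ ∧ ∃ γ₁ : ℝ, 0 < γ₁ ∧ γ₁ ≤ 1 ∧
      ∀ (F : T3Family) (γ : ℝ), F.L = L → 0 < γ → γ ≤ γ₁ → ∃ (D ρ : ℝ), 0 ≤ D ∧ 0 ≤ ρ ∧ ρ * (L : ℝ) ^ 3 < 1 ∧
        ∀ (K j : ℕ), 1 ≤ j → j ≤ K → ∀ (p : Plaq (F.P K) j),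
          (gibbsK F ℰp γ K).real {U | θBal F.L γ b₀ p₀ (K - j) ≤
              GaugeGroup.dist1 (GaugeField.plaqHol (Averaging.iter (fun i => BlockAveraging.blockAvg (P := F.P K) (j := i) ℰp) j U) p)}
            ≤ D * ρ ^ (K - j)) →
    Summit.QuantumFields.YangMills.Theses.UnitScaleTilt.HistoryTailL :=
  historyTailL_of_geometricTail

end Summit.QuantumFields.YangMills.Theorems.EntropyFloorHistoryTailOfGeometric

end
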